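import Summits.Langlands.Langlands.Theorems.SqrtFiveQuarticCoversCertificates
import HarnessLib

/-!
# Route `Langlands/SqrtFiveQuarticCovers`, crux `RefinedLocusModular` — the certificate `CertS3H12`
# (hypothesis `hD` of `refinedLocusModular_of_certificates`; sheet 4.7, redundantly 4.3) reduced to
# ONE certified finite datum (CASE 2 EMPTY on the explicit model of `X(s3,H12)`) and ONE named
# model-identification input, by kernel-checked algebra

Cell `pub/lg-quartmod` (F-L1), typist seat typ-3; lead's SHEET-WORDS v0.1 (2026-08-28T20:36Z) and
CENSUS.md §15 row 4.7 are the words of record.  LABEL OF RECORD: «`RefinedLocusModular` closed in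
tree MODULO named printed theorems + named certified finite computations (two independent exact
lineages each)».  **A certified finite datum is not a modularity statement.**  Nothing in this file
proves modularity of any elliptic curve; it is bookkeeping that says EXACTLY which finite datum and
which model identification the certificate `hD` («`K` totally real quartic, `√5 ∈ K`, `E / 𝓞 K`
with `Δ ≠ 0`, mod-`3` image in `C_s⁺(3) = N_s(3)` and mod-`5` image in `H12` for some framings
⟹ `E` has CM or `j(E) ∈ ℚ(√5)`», mod-`7` free) rests on, and checks the algebra in between.

## The carrier and its explicit model (cell eng-4, `HOME/lg-quartmod-eng-4/evidence/e8/E8-MODELS.md`)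

`k = ℚ(√5)`, `c = 5 + 2√5`, `q(t) = 8t² − 12t + 7`.  Printed inputs: Zywina's hauptmoduln
`J₂(u) = 27(u+1)³(u−3)³/u³` for `X_{N_s(3)} = X(s3) ≅ ℙ¹_u` [Zywina2015, §1.2] and
`J₇(t) = 5³(t+1)(2t+1)³(2t²−3t+3)³/(t²+t−1)⁵` for `X_{N_ns(5)} = X(ns⁺5) ≅ ℙ¹_t`
[Zywina2015, §1.3, Thm. 1.4; = Chen 1999 (53) after `t ↦ −t−1`]; the moduli interpretation of
`X_H(K)` for any field `K` [Chen 1999 Thm. 3.2, citing Deligne–Rapoport IV-3].  The tower: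

* `E := X(ns3, ns⁺5) = {m³ = J₇(t)} ≅ 225a1`, normalised as the plane cubic `n³ = t³ + 2t² − 1`
  with `m = 5(2t+1)(2t²−3t+3)·n/(t²+t−1)²` (`j = m³`); KEY IDENTITY `J₂(u) = m(u)³`,
  `m(u) = 3(u+1)(u−3)/u`, so `X(s3) → X(ns3) = ℙ¹_m` is `u ↦ m(u)` with fibre
  `u² − (2 + m/3)u − 3 = 0` of discriminant `(m² + 12m + 144)/9`;
* `Y₂ := X(s3, ns⁺5)` (genus `3`, over `ℚ`) `= {v² = m² + 12m + 144}` over `E`;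
* `X := X(s3, H12)` (genus `7`, over `k`) `= {v² = m² + 12m + 144, c·w² = q(t)}` over `E_k`
  (the `H12`-refinement of the `ns⁺5`-structure is the conic `c·w² = q(t)` over `ℙ¹_t`: CENSUS §3.2/§11,
  validated by point counts on three code lineages — the cell's model identification, NOT print).

Division-free coordinates used below: `(t, n, ṽ, w)` with `ṽ = (t²+t−1)²·v`, i.e.
`ṽ² = M² + 12·M·D + 144·D²`, `M = 5(2t+1)(2t²−3t+3)·n`, `D = (t²+t−1)²`.  This affine model
contains every point of `X` except the four points over `t = ∞` (`j = 8000`); over a totally real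
field its only singular points are the cusps (`t² + t − 1 = 0`, nodes), since `m² + 12m + 144 =
(m+6)² + 108` and `q(t)` have no real zero — so a point of the model with coordinates in a totally
real quartic `K ⊃ k` is a cusp or a smooth point, i.e. a point of `X` of degree `≤ 2` over `k`.

## The two named inputs (HYPOTHESES of the theorem, written out; D-0027 §2.1: no Prop definitions
## under `Summits/` other than registered obligations — the texts are offered to the planner seat
## `lg-quartmod-asm-plan` for registration as children of `CertS3H12`)

* `hDat` — **CASE 2 EMPTY (certified finite datum, sheet 4.7).**  «For `K` totally real quartic,
  `r ∈ K`, `r² = 5`: every `K`-point `(t, n, ṽ, w)` of the model has `t, n ∈ ℚ + ℚ·r`.»  This is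
  THEOREM (E8, CASE 2) of the cell — «`X(s3,H12)` has NO quadratic point over `k = ℚ(√5)` lying
  over a non-`k`-rational point of `E = X(ns3,ns⁺5) = 225a1`; hence every point of `X(s3,H12)` of
  degree `≤ 2` over `k` is a cusp (8, all `k`-rational) or a CASE-1 point `(R, ±√A(R), ±√B(R))`
  with `R ∈ E(k)`, whose `j`-invariant `J₇(t(R))` lies in `k`» — restricted to totally real `K`
  and weakened to its `(t, n)`-coordinates (the two signs of `r` give `k`-isomorphic models:
  `w ↦ (5+2r)w/r`).  LINEAGE A (producer): eng-4, `E8-PRYMSIEVE.md` sha16 9627b62afbb4b0bc §FINAL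
  (Prym sieve through `γ : Y₂ → Pic²(X(b3,ns⁺5))`, invariant in `T_b = J(X(b3,ns⁺5))(k)`, lemmas
  L1–L8, sieve v13/v14 at the primes of `k` above 11, 19, 29, 31, 41; 39/39 non-zero classes of
  `C_b` X-certified, `H`-hits `= ∅` at `𝔮 ∣ 19`, class `0` = `ν₃`-pullbacks), certnum packet
  `certnum-E8/packet.json` sha16 7e0d93234f2d4641; audit (a)–(e) PASS (eng-5 R5-AUDIT-E8-CASE2.md
  83cec89f0de657ed, ref-1 AUDIT-4.7-bde.md 960e76e64becaf0b).  LINEAGE B (method-disjoint twin):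
  eng-5, `R5-E8-CASE2-6D.md` sha16 d4b61a9354412577 (`β = 1 − ν₃` sieve on `X(s3,ns⁺5)` itself, own
  model, own lift test `B ∉ K²` 10/10).  LINEAGE C (third, `ε`-Prym `α`-sieve on `X(s3,H12)` itself):
  eng-6 g2 E12-REPORT.md DRAFT 8dfc96268d96d250 + eng-3 g2 twin — RUNNING at the time of typing.
  certnum (pub/certnum/RELEASES.md, ratpcert 0.7.0): l.144 K-a LV0 (`L(225b1,1) ≠ 0`; the level-75
  rows of l.123), l.145 K-b R0 (`rank 225a1(ℚ) = 1` unconditional, `225b1(ℚ) = ℤ/3`, rank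
  `225a1(k) = 1`); RQ-028 OPEN (K-c MWQ `E(k) = ℤG ⊕ ℤ/3·T`, K-d…K-g, Phase 2 PRYM-REPLAY booked).
  NAMED INPUTS it rests on, as listed by the producers: the model tower above (print `J₂`, `J₇` +
  the cell's conic class `c`); `E(k) = ℤ·(1,1) ⊕ ℤ/3·T` (mwrank 2-descent over `ℚ` for 225a1/225b1,
  saturation); `#J(X(b3,ns⁺5))(k) ∣ 80` from exact point counts and `C_b ≅ ℤ/2×ℤ/4×ℤ/5`
  (`T_b = ℤ/40 ⊕ ℤ/2` decided by eng-5, not needed; rank `0` of `J(X(b3,ns⁺5))(k)` = mwrank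
  2-descents for 75b1, 15a1, 75c1, 75a1, the exact `L`-values of certnum l.123/l.144 being the
  Kolyvagin–Logachev/Kato form of the same input; injectivity of reduction on `T_b` checked directly
  at `𝔮 ∣ 11, 19, 29`); lemmas L1–L8 (Abel–Prym injectivity off `|K|`, Gauss map = canonical
  direction of the anti-invariant differentials, étale ⟹ unique lift (Katz–Mazur-type torsion /
  unramifiedness input), push-forward classes); the finite-field enumerations (certnum certifies ONLY
  the finite data named in its release lines; the sieve replay itself is RQ-028 Phase 2, booked).
  CM theory is NOT an input of this certificate: CASE 1 yields `j ∈ ℚ(√5)` outright.  (For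
  «`X(k)` = 8 cusps» additionally rank `E′(k) = 0`, `E′ = 75a1^(δ)`: 2-descent / certnum LV0 l.123
  + Kato — not used by `hDat`.)
* `hNF` — **MODEL IDENTIFICATION NF-K1 for `X(s3,H12)` (named, not proved: the tree has no
  modular-curve carrier).**  «For `K` totally real quartic with `r ∈ K`, `r² = 5`, and `E / 𝓞 K`
  (`Δ ≠ 0`) with a framing of `E[3]` valued in `N_s(3) = ⟨diag(1,2), antidiag(1,1)⟩` and a framing
  of `E[5]` valued in `H12 = ⟨(3 1;3 3), diag(1,4)⟩ ⊂ N_ns(5)` (Zywina's coordinates: `C_ns(5) =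
  {(a 2b; b a)}`): `j(E) = 0`, or `j(E) = 8000` (the point `t = ∞` of `X(ns⁺5)`), or there are
  `u, t, w ∈ K` with `u ≠ 0`, `j(E) = J₂(u)`, `t² + t − 1 ≠ 0`, `j(E) = J₇(t)` and
  `(5 + 2r)·w² = 8t² − 12t + 7`» (division-free through `j = c₄³/Δ`).  PRINT behind it: a
  `G_K`-invariant `G`-class of level structures is a `K`-point of `Y_G` and `π_G` forgets the level
  structure [Chen 1999 Thm. 3.2; Deligne–Rapoport 1973 IV-3; Box 2022 §1.1]; `X_{N_s(3)} ≅ ℙ¹` with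
  `π = J₂` and `X_{N_ns(5)} ≅ ℙ¹` with `π = J₇` [Zywina2015 §1.2–1.3, Lemma 3.4, §4.2–4.3] (Zywina
  states Thms. 1.2/1.4 for `E/ℚ` non-CM; the curve isomorphisms are statements about `X_G`).  CELL
  (not print): the `H12`-refinement `X_{H12} → X(ns⁺5)` is the conic `(5+2√5)·w² = 8t² − 12t + 7`
  over `k` in Zywina's coordinate `t` (branch quadratic = the simple factor of the numerator of
  `J₇ − 1728`, lit-1 LIT-L1-L4.md §L4; conic class CENSUS §11; three-lineage point-count validation
  E8-MODELS.md §v3 (A)).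

## What is PROVED here (kernel-checked)

* `sq_eq_of_mul_eq` — the fibre identity `(6u − 6 − m)² = m² + 12m + 144` on `m·u = 3(u+1)(u−3)`
  (eng-4's KEY IDENTITY `J₂ = m³` and the `X(s3) → X(ns3)` fibre discriminant).
* `exists_rat_add_rat_mul_of_mem_adjoin` — every element of `ℚ⟮r⟯ ⊆ K` (`r² = 5`) is `a + b·r`.
* `certS3H12_of_modelIdentification_of_caseTwoEmpty` — **`hNF → hDat → CertS3H12`**, the route item
  stmt-Langlands-23417 (route rev 7; its body is VERBATIM the hypothesis type `hD` of
  `refinedLocusModular_of_certificates`, p653708): from `(u, t, w)` build the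
  model point `n = m(t²+t−1)²/(5(2t+1)(2t²−3t+3))`, `ṽ = (t²+t−1)²(6u − 6 − m)` (the degenerate
  parameters `t = −1`, `2t+1 = 0`, `2t²−3t+3 = 0` force `c₄ = 0`, i.e. `j = 0 ∈ ℚ(√5)`), apply
  `hDat` to get `t ∈ ℚ + ℚr`, and conclude `j = J₇(t) ∈ ℚ(√5)` because `ℚ⟮r⟯` is a field.
  In particular the CM alternative of `hD` is never needed: CASE 1 gives `j ∈ ℚ(√5)` outright
  (CASE-1 `j`-values met by the cell: `0`, `8000` (CM) and `−28079 ± 12510√5`, non-CM over the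
  totally real quartic `ℚ(θ)`, `θ⁴ − θ³ − 10θ² + 2θ + 19` — harmless via `jInSqrtFive_modular_of_facts`).

HONEST STATUS: CONDITIONAL bookkeeping (two hypotheses, both named above with their provenance);
closes nothing on the ledger by itself; «a certified finite datum is not a modularity statement».
References: [Zywina2015] arXiv:1508.07660 §1.2, §1.3 (Thm. 1.4), §3.2 (Lemma 3.4), §4;
[DeligneRapoport1973] IV-3; [Box2022] §1.1, §7.1; [FreitasLeHungSiksek2015] Remark (iii) after
Cor. 2.1 (the group `H12`).  Chen, *On Siegel's modular curve of level 5 and the class number one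
problem*, J. Number Theory 74 (1999), Thm. 3.2 and (53).
-/

noncomputable section

set_option linter.dupNamespace false -- project-wide option; `Summit.Langlands.Langlands` is the mandated namespace

open scoped Matrix NumberField Polynomial IntermediateField
open NumberField Polynomial
open Literature.NumberTheory.Automorphic Summit.Langlands.Langlands.Theses.SqrtFiveQuarticCovers

namespace Summit.Langlands.Langlands.Theorems.SqrtFiveQuarticCovers

/-! ### §1 The fibre identity of `X(s3) → X(ns3)` -/

/-- The fibre of `X(s3) → X(ns3)` over `m`: if `m·u = 3(u+1)(u−3)` then `v := 6u − 6 − m`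
satisfies `v² = m² + 12m + 144` (the equation of `X(s3,ns⁺5)` over `X(ns3,ns⁺5)`). [folklore] -/
theorem sq_eq_of_mul_eq {R : Type*} [CommRing R] {m u : R} (h : m * u = 3 * (u + 1) * (u - 3)) :
    (6 * u - 6 - m) ^ 2 = m ^ 2 + 12 * m + 144 := by
  linear_combination (-12 : R) * h

/-! ### §2 The real quadratic subfield `ℚ(r)`, `r² = 5` -/

/-- Every element of `ℚ⟮r⟯ ⊆ K` (`r² = 5`) is of the form `a + b·r` with `a b : ℚ`
(`minpoly_ℚ r = X² − 5` has degree `2`; power basis `1, r`). [folklore] -/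
theorem exists_rat_add_rat_mul_of_mem_adjoin {K : Type} [Field K] [CharZero K] {r x : K}
    (hr : r ^ 2 = 5) (hx : x ∈ ℚ⟮r⟯) : ∃ a b : ℚ, x = (a : K) + (b : K) * r := by
  have hr_int : IsIntegral ℚ r :=
    ⟨X ^ 2 - C 5, monic_X_pow_sub_C (5 : ℚ) two_ne_zero, by simp [hr]⟩
  obtain ⟨f, hf, hxf⟩ := (IntermediateField.adjoin.powerBasis hr_int).exists_eq_aeval ⟨x, hx⟩
  rw [IntermediateField.adjoin.powerBasis_dim, minpoly_eq_X_sq_sub_five hr,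
    natDegree_X_pow_sub_C] at hf
  obtain ⟨a, b, hfab⟩ := exists_eq_X_add_C_of_natDegree_le_one (Nat.lt_succ_iff.mp hf)
  refine ⟨b, a, ?_⟩
  have h : x = aeval r f := by
    have h' := congrArg Subtype.val hxf
    rw [IntermediateField.adjoin.powerBasis_gen,
      IntermediateField.AdjoinSimple.coe_aeval_gen_apply] at h'
    exact h'
  rw [h, hfab]
  simp only [map_add, map_mul, aeval_C, aeval_X, eq_ratCast]
  ring

/-- Conversely `a + b·r ∈ ℚ⟮r⟯`. [folklore] -/
theorem rat_add_rat_mul_mem_adjoin {K : Type} [Field K] [CharZero K] (r : K) (a b : ℚ) :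
    (a : K) + (b : K) * r ∈ ℚ⟮r⟯ := by
  refine add_mem ?_ (mul_mem ?_ (IntermediateField.mem_adjoin_simple_self ℚ r))
  · rw [← eq_ratCast (algebraMap ℚ K) a]; exact ℚ⟮r⟯.algebraMap_mem a
  · rw [← eq_ratCast (algebraMap ℚ K) b]; exact ℚ⟮r⟯.algebraMap_mem b

/-- `J₇(t) ∈ ℚ⟮r⟯` when `t ∈ ℚ⟮r⟯` (a subfield is closed under rational functions). [folklore] -/
theorem J7_mem_adjoin {K : Type} [Field K] [CharZero K] {r t : K} (ht : t ∈ ℚ⟮r⟯) :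
    125 * (t + 1) * (2 * t + 1) ^ 3 * (2 * t ^ 2 - 3 * t + 3) ^ 3 / (t ^ 2 + t - 1) ^ 5 ∈ ℚ⟮r⟯ := by
  have h1 : (1 : K) ∈ ℚ⟮r⟯ := one_mem _
  refine div_mem (mul_mem (mul_mem (mul_mem (ofNat_mem _ 125) (add_mem ht h1)) (pow_mem ?_ 3))
    (pow_mem ?_ 3)) (pow_mem (sub_mem (add_mem (pow_mem ht 2) ht) h1) 5)
  · exact add_mem (mul_mem (ofNat_mem _ 2) ht) h1
  · exact add_mem (sub_mem (mul_mem (ofNat_mem _ 2) (pow_mem ht 2)) (mul_mem (ofNat_mem _ 3) ht))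
      (ofNat_mem _ 3)

/-! ### §3 `CertS3H12` (= `hD`) from the model identification and CASE 2 EMPTY -/

/-- **`CertS3H12` from NF-K1 and CASE 2 EMPTY.**  Hypotheses (written out, see the module docstring
for their provenance): `hNF` = model identification NF-K1 for `X(s3,H12)` (moduli interpretation
[Chen 1999 Thm. 3.2 / Deligne–Rapoport IV-3] + Zywina's `J₂`, `J₇` [Zywina2015 §1.2–1.3] + the
cell's conic `(5+2√5)w² = 8t²−12t+7`; named, not proved); `hDat` = the certified finite datum
«CASE 2 EMPTY» (cell THEOREM (E8, CASE 2): eng-4 E8-PRYMSIEVE.md 9627b62afbb4b0bc / certnum-E8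
packet 7e0d93234f2d4641; eng-5 R5-E8-CASE2-6D.md d4b61a9354412577; certnum RELEASES l.144, l.145,
RQ-028).  Conclusion: the route item `CertS3H12` (stmt-Langlands-23417; = VERBATIM the hypothesis `hD` of
`refinedLocusModular_of_certificates`, p653708) — for
`K` totally real quartic with `√5 ∈ K` and `E / 𝓞 K` (`Δ ≠ 0`) with mod-`3` image in `N_s(3)` and
mod-`5` image in `H12` (some framings), `E` has CM or `c₄³ = (a + b√5)·Δ` with `a b : ℚ`.
Proof: the degenerate parameters give `c₄ = 0`; otherwise `m = 3(u+1)(u−3)/u`,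
`n = m(t²+t−1)²/(5(2t+1)(2t²−3t+3))`, `ṽ = (t²+t−1)²(6u−6−m)` is a `K`-point of the model
(`n³ = t³+2t²−1` from `J₂(u) = J₇(t) = j`, `ṽ²` by `sq_eq_of_mul_eq`), `hDat` puts `t` in
`ℚ + ℚr`, and `j = J₇(t) ∈ ℚ⟮r⟯ = ℚ + ℚr`.  CONDITIONAL bookkeeping; a certified finite datum is
not a modularity statement. [cite: Zywina2015, §1.2–1.3, Lemma 3.4] [cite: Box2022, §1.1, §7.1] -/
theorem certS3H12_of_modelIdentification_of_caseTwoEmpty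
    (hNF : ∀ (K : Type) [Field K] [NumberField K], NumberField.IsTotallyReal K → Module.finrank ℚ K = 4 → (∃ r : K, r ^ 2 = 5) →
        ∀ E : WeierstrassCurve (NumberField.RingOfIntegers K), E.Δ ≠ 0 →
          (∃ ρ : Literature.NumberTheory.GaloisRepresentations.FramedGaloisRep K (ZMod 3) 2, (∃ e : (E.baseChange K).geomTorsion ((3 : ℕ) : ℤ) ≃+ (Fin 2 → ZMod 3), ∀ (σ : Field.absoluteGaloisGroup K) (P : (E.baseChange K).geomTorsion ((3 : ℕ) : ℤ)), e (σ • P) = ((ρ σ : GL (Fin 2) (ZMod 3)) : Matrix (Fin 2) (Fin 2) (ZMod 3)) *ᵥ (e P)) ∧ ((∀ σ : Field.absoluteGaloisGroup K, (ρ σ : GL (Fin 2) (ZMod 3)) ∈ Subgroup.closure ({(⟨!![1, 0; 0, 2], !![1, 0; 0, 2], by decide, by decide⟩ : GL (Fin 2) (ZMod 3)), (⟨!![0, 1; 1, 0], !![0, 1; 1, 0], by decide, by decide⟩ : GL (Fin 2) (ZMod 3))} : Set (GL (Fin 2) (ZMod 3)))))) →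
          (∃ ρ : Literature.NumberTheory.GaloisRepresentations.FramedGaloisRep K (ZMod 5) 2, (∃ e : (E.baseChange K).geomTorsion ((5 : ℕ) : ℤ) ≃+ (Fin 2 → ZMod 5), ∀ (σ : Field.absoluteGaloisGroup K) (P : (E.baseChange K).geomTorsion ((5 : ℕ) : ℤ)), e (σ • P) = ((ρ σ : GL (Fin 2) (ZMod 5)) : Matrix (Fin 2) (Fin 2) (ZMod 5)) *ᵥ (e P)) ∧ ((∀ σ : Field.absoluteGaloisGroup K, (ρ σ : GL (Fin 2) (ZMod 5)) ∈ Subgroup.closure ({(⟨!![3, 1; 3, 3], !![3, 4; 2, 3], by decide, by decide⟩ : GL (Fin 2) (ZMod 5)), (⟨!![1, 0; 0, 4], !![1, 0; 0, 4], by decide, by decide⟩ : GL (Fin 2) (ZMod 5))} : Set (GL (Fin 2) (ZMod 5)))))) →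
          ∀ r : K, r ^ 2 = 5 →
            (E.baseChange K).c₄ = 0 ∨
            (E.baseChange K).c₄ ^ 3 = 8000 * (E.baseChange K).Δ ∨
            ∃ u t w : K, u ≠ 0 ∧
              (E.baseChange K).c₄ ^ 3 * u ^ 3 = 27 * (u + 1) ^ 3 * (u - 3) ^ 3 * (E.baseChange K).Δ ∧
              t ^ 2 + t - 1 ≠ 0 ∧
              (E.baseChange K).c₄ ^ 3 * (t ^ 2 + t - 1) ^ 5 =
                125 * (t + 1) * (2 * t + 1) ^ 3 * (2 * t ^ 2 - 3 * t + 3) ^ 3 * (E.baseChange K).Δ ∧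
              (5 + 2 * r) * w ^ 2 = 8 * t ^ 2 - 12 * t + 7)
    (hDat : ∀ (K : Type) [Field K] [NumberField K], NumberField.IsTotallyReal K → Module.finrank ℚ K = 4 →
        ∀ r : K, r ^ 2 = 5 →
          ∀ t n v w : K,
            n ^ 3 = t ^ 3 + 2 * t ^ 2 - 1 →
            v ^ 2 = (5 * (2 * t + 1) * (2 * t ^ 2 - 3 * t + 3) * n) ^ 2
                + 12 * (5 * (2 * t + 1) * (2 * t ^ 2 - 3 * t + 3) * n) * (t ^ 2 + t - 1) ^ 2
                + 144 * (t ^ 2 + t - 1) ^ 4 →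
            (5 + 2 * r) * w ^ 2 = 8 * t ^ 2 - 12 * t + 7 →
            (∃ a b : ℚ, t = (a : K) + (b : K) * r) ∧ (∃ a b : ℚ, n = (a : K) + (b : K) * r)) :
    CertS3H12 := by
  intro K _ _ hK hd hr5 E hΔ h3 h5
  obtain ⟨r, hr⟩ := hr5
  -- `Δ(E ⊗ K) ≠ 0`
  have hΔK : (E.baseChange K).Δ ≠ 0 := by
    rw [WeierstrassCurve.baseChange, WeierstrassCurve.map_Δ]
    exact (map_ne_zero_iff _ (FaithfulSMul.algebraMap_injective (𝓞 K) K)).2 hΔ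
  right
  refine ⟨r, hr, ?_⟩
  rcases hNF K hK hd ⟨r, hr⟩ E hΔ h3 h5 r hr with h0 | h8000 | ⟨u, t, w, hu, hJ2, hDt, hJ7, hW⟩
  · -- `j = 0`
    exact ⟨0, 0, by simp [h0]⟩
  · -- `j = 8000` (the point `t = ∞`)
    exact ⟨8000, 0, by rw [h8000]; push_cast; ring⟩
  · by_cases hP : (t + 1) * (2 * t + 1) * (2 * t ^ 2 - 3 * t + 3) = 0
    · -- degenerate parameter: `j = 0`
      have hc : (E.baseChange K).c₄ ^ 3 = 0 := by
        have h : (E.baseChange K).c₄ ^ 3 * (t ^ 2 + t - 1) ^ 5 =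
            125 * ((t + 1) * (2 * t + 1) * (2 * t ^ 2 - 3 * t + 3)) *
              ((2 * t + 1) ^ 2 * (2 * t ^ 2 - 3 * t + 3) ^ 2) * (E.baseChange K).Δ := by
          rw [hJ7]; ring
        rw [hP, mul_zero, zero_mul, zero_mul] at h
        exact (mul_eq_zero.mp h).resolve_right (pow_ne_zero 5 hDt)
      exact ⟨0, 0, by simp [hc]⟩
    · have ht1 : t + 1 ≠ 0 := fun h => hP (by rw [h]; ring)
      have h2t : 2 * t + 1 ≠ 0 := fun h => hP (by rw [h]; ring)
      have hq3 : 2 * t ^ 2 - 3 * t + 3 ≠ 0 := fun h => hP (by rw [h]; ring)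
      -- the `X(ns3)` coordinate `m = ∛j`
      obtain ⟨m, hm⟩ : ∃ m : K, m = 3 * (u + 1) * (u - 3) / u := ⟨_, rfl⟩
      have hmu : m * u = 3 * (u + 1) * (u - 3) := by rw [hm]; field_simp
      have hm3 : m ^ 3 * (E.baseChange K).Δ = (E.baseChange K).c₄ ^ 3 := by
        have h : m ^ 3 * u ^ 3 * (E.baseChange K).Δ = (E.baseChange K).c₄ ^ 3 * u ^ 3 := by
          rw [hJ2, show m ^ 3 * u ^ 3 = (m * u) ^ 3 by ring, hmu]; ring
        have hu3 : u ^ 3 ≠ 0 := pow_ne_zero 3 hu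
        apply mul_right_cancel₀ hu3
        linear_combination h
      -- `m³ = J₇(t)` division-free
      have hm3t : m ^ 3 * (t ^ 2 + t - 1) ^ 5 =
          125 * (t + 1) * (2 * t + 1) ^ 3 * (2 * t ^ 2 - 3 * t + 3) ^ 3 := by
        apply mul_right_cancel₀ hΔK
        linear_combination (t ^ 2 + t - 1) ^ 5 * hm3 + hJ7
      -- the point of the normalised cubic `n³ = t³ + 2t² − 1`
      obtain ⟨n, hn⟩ : ∃ n : K, n = m * (t ^ 2 + t - 1) ^ 2 / (5 * (2 * t + 1) * (2 * t ^ 2 - 3 * t + 3)) :=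
        ⟨_, rfl⟩
      have h5P : (5 : K) * (2 * t + 1) * (2 * t ^ 2 - 3 * t + 3) ≠ 0 :=
        mul_ne_zero (mul_ne_zero (by norm_num) h2t) hq3
      have h5n : 5 * (2 * t + 1) * (2 * t ^ 2 - 3 * t + 3) * n = m * (t ^ 2 + t - 1) ^ 2 := by
        linear_combination (eq_div_iff h5P).mp hn
      have hn3 : n ^ 3 = t ^ 3 + 2 * t ^ 2 - 1 := by
        have h125 : (125 : K) * ((2 * t + 1) * (2 * t ^ 2 - 3 * t + 3)) ^ 3 ≠ 0 :=
          mul_ne_zero (by norm_num) (pow_ne_zero 3 (mul_ne_zero h2t hq3))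
        apply mul_left_cancel₀ h125
        have h : (5 * (2 * t + 1) * (2 * t ^ 2 - 3 * t + 3) * n) ^ 3 = (m * (t ^ 2 + t - 1) ^ 2) ^ 3 := by
          rw [h5n]
        -- `(5Pn)³ = m³ (t²+t−1)⁶ = 125 (t+1) P³ (t²+t−1)`
        linear_combination h + (t ^ 2 + t - 1) * hm3t
      -- the `X(s3)`-coordinate: `ṽ² = M² + 12MD + 144D²`
      have hv : ((t ^ 2 + t - 1) ^ 2 * (6 * u - 6 - m)) ^ 2 =
          (5 * (2 * t + 1) * (2 * t ^ 2 - 3 * t + 3) * n) ^ 2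
            + 12 * (5 * (2 * t + 1) * (2 * t ^ 2 - 3 * t + 3) * n) * (t ^ 2 + t - 1) ^ 2
            + 144 * (t ^ 2 + t - 1) ^ 4 := by
        rw [h5n, mul_pow, sq_eq_of_mul_eq hmu]; ring
      -- CASE 2 EMPTY
      obtain ⟨⟨a, b, hab⟩, -⟩ := hDat K hK hd r hr t n _ w hn3 hv hW
      have ht_mem : t ∈ ℚ⟮r⟯ := hab ▸ rat_add_rat_mul_mem_adjoin r a b
      obtain ⟨a', b', hj⟩ := exists_rat_add_rat_mul_of_mem_adjoin hr (J7_mem_adjoin ht_mem)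
      refine ⟨a', b', ?_⟩
      rw [← hj, div_mul_eq_mul_div, eq_div_iff (pow_ne_zero 5 hDt)]
      exact hJ7

/-! ### §4 (append) The certified datum restricted to SMOOTH points of the model

Over a totally real number field the affine model has `w ≠ 0` everywhere and `ṽ = 0` only at the
cusps `t² + t − 1 = 0` (real-embedding arguments: `8t²−12t+7 = 8(t−3/4)² + 5/2`,
`M² + 12MD + 144D² = (M+6D)² + 108D²`).  A point with `ṽ·w ≠ 0` is a smooth point of the model
(the cubic `n³ = t³+2t²−1` is smooth), i.e. a point of `X(s3,H12)` with residue field `⊆ K`; so the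
datum may be asked about such points only (`hDat'` below — WEAKER than `hDat`, and ≤ the cell's
THEOREM (E8, CASE 2) with no singularity argument left to the reader), and it implies `hDat`:
at a cusp `t = (−1 ± r)/2`, `n = 0` lie in `ℚ + ℚr` anyway. -/

/-- Over a totally real number field `8t² − 12t + 7 ≠ 0` (`= 8(t − 3/4)² + 5/2` under a real
embedding): the `H12`-conic `(5+2r)w² = 8t²−12t+7` has no point with `w = 0`. [folklore] -/
theorem branchQuadratic_ne_zero {K : Type} [Field K] [NumberField K] [IsTotallyReal K] (t : K) :
    8 * t ^ 2 - 12 * t + 7 ≠ 0 := by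
  obtain ⟨w⟩ := (inferInstance : Nonempty (NumberField.InfinitePlace K))
  let φ := NumberField.InfinitePlace.embedding_of_isReal (IsTotallyReal.isReal w)
  intro h
  have h' := congrArg φ h
  simp only [map_sub, map_add, map_mul, map_pow, map_ofNat, map_zero] at h'
  nlinarith [sq_nonneg (φ t - 3 / 4)]

/-- Over a totally real number field a point of the model with `ṽ = 0` is a cusp:
`M² + 12MD + 144D² = 0` (`M = 5(2t+1)(2t²−3t+3)n`, `D = (t²+t−1)²`) forces `t² + t − 1 = 0`
(`(M+6D)² + 108D² = 0` under a real embedding). [folklore] -/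
theorem cusp_of_vtilde_sq_eq_zero {K : Type} [Field K] [NumberField K] [IsTotallyReal K]
    {t n : K}
    (h : (5 * (2 * t + 1) * (2 * t ^ 2 - 3 * t + 3) * n) ^ 2
        + 12 * (5 * (2 * t + 1) * (2 * t ^ 2 - 3 * t + 3) * n) * (t ^ 2 + t - 1) ^ 2
        + 144 * (t ^ 2 + t - 1) ^ 4 = 0) :
    t ^ 2 + t - 1 = 0 := by
  obtain ⟨w⟩ := (inferInstance : Nonempty (NumberField.InfinitePlace K))
  let φ := NumberField.InfinitePlace.embedding_of_isReal (IsTotallyReal.isReal w)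
  have h' := congrArg φ h
  simp only [map_sub, map_add, map_mul, map_pow, map_ofNat, map_zero, map_one] at h'
  have hsum : (5 * (2 * φ t + 1) * (2 * φ t ^ 2 - 3 * φ t + 3) * φ n + 6 * (φ t ^ 2 + φ t - 1) ^ 2) ^ 2
      + 108 * ((φ t ^ 2 + φ t - 1) ^ 2) ^ 2 = 0 := by
    linear_combination h'
  have h108 : 108 * ((φ t ^ 2 + φ t - 1) ^ 2) ^ 2 = 0 :=
    ((add_eq_zero_iff_of_nonneg (sq_nonneg _) (by positivity)).mp hsum).2
  have hD : φ t ^ 2 + φ t - 1 = 0 := by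
    have h4 : ((φ t ^ 2 + φ t - 1) ^ 2) ^ 2 = 0 := by linarith
    exact (pow_eq_zero_iff two_ne_zero).mp ((pow_eq_zero_iff two_ne_zero).mp h4)
  have ht : φ (t ^ 2 + t - 1) = 0 := by simpa [map_sub, map_add, map_pow, map_one] using hD
  exact (map_eq_zero_iff φ φ.injective).mp ht

/-- The datum on smooth points implies the datum on all points of the model: a point with `w = 0`
does not exist and a point with `ṽ = 0` is a cusp, `t = (−1 ± r)/2`, `n = 0`. [folklore] -/
theorem caseTwo_of_smooth {K : Type} [Field K] [NumberField K] [IsTotallyReal K] {r : K}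
    (hr : r ^ 2 = 5) {t n v w : K} (hn : n ^ 3 = t ^ 3 + 2 * t ^ 2 - 1)
    (hv : v ^ 2 = (5 * (2 * t + 1) * (2 * t ^ 2 - 3 * t + 3) * n) ^ 2
        + 12 * (5 * (2 * t + 1) * (2 * t ^ 2 - 3 * t + 3) * n) * (t ^ 2 + t - 1) ^ 2
        + 144 * (t ^ 2 + t - 1) ^ 4)
    (hW : (5 + 2 * r) * w ^ 2 = 8 * t ^ 2 - 12 * t + 7)
    (hsm : v ≠ 0 → w ≠ 0 →
      (∃ a b : ℚ, t = (a : K) + (b : K) * r) ∧ (∃ a b : ℚ, n = (a : K) + (b : K) * r)) :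
    (∃ a b : ℚ, t = (a : K) + (b : K) * r) ∧ (∃ a b : ℚ, n = (a : K) + (b : K) * r) := by
  have hw : w ≠ 0 := by
    rintro rfl
    exact branchQuadratic_ne_zero t (by rw [← hW]; ring)
  by_cases hv0 : v = 0
  · have hD : t ^ 2 + t - 1 = 0 := cusp_of_vtilde_sq_eq_zero (n := n) (by rw [← hv, hv0]; ring)
    have hn0 : n = 0 := by
      have h3 : n ^ 3 = 0 := by rw [hn]; linear_combination (t + 1) * hD
      exact (pow_eq_zero_iff three_ne_zero).mp h3
    have ht : (2 * t + 1 - r) * (2 * t + 1 + r) = 0 := by linear_combination 4 * hD - hr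
    refine ⟨?_, ⟨0, 0, by simp [hn0]⟩⟩
    rcases mul_eq_zero.mp ht with h | h
    · exact ⟨-1 / 2, 1 / 2, by push_cast; linear_combination h / 2⟩
    · exact ⟨-1 / 2, -1 / 2, by push_cast; linear_combination h / 2⟩
  · exact hsm hv0 hw

/-- **`CertS3H12` from NF-K1 and the certified datum asked about SMOOTH points only** (`hDat'`:
the points of the model with `ṽ ≠ 0`, `w ≠ 0` — points of `X(s3,H12)` of degree `≤ 2` over `k` —
lie over `225a1(k)`; ≤ THEOREM (E8, CASE 2) of the cell, lineages eng-4 9627b62afbb4b0bc / eng-5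
d4b61a9354412577 / eng-3 g2 E12 TWIN THEOREM Z′ (cell STATUS 2026-08-28T20:56:11Z); certnum l.144,
l.145, RQ-028 open).  By `caseTwo_of_smooth` and `certS3H12_of_modelIdentification_of_caseTwoEmpty`.
CONDITIONAL bookkeeping; a certified finite datum is not a modularity statement.
[cite: Zywina2015, §1.2–1.3] [cite: Box2022, §1.1, §7.1] -/
theorem certS3H12_of_modelIdentification_of_caseTwoEmpty_smooth
    (hNF : ∀ (K : Type) [Field K] [NumberField K], NumberField.IsTotallyReal K → Module.finrank ℚ K = 4 → (∃ r : K, r ^ 2 = 5) →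
        ∀ E : WeierstrassCurve (NumberField.RingOfIntegers K), E.Δ ≠ 0 →
          (∃ ρ : Literature.NumberTheory.GaloisRepresentations.FramedGaloisRep K (ZMod 3) 2, (∃ e : (E.baseChange K).geomTorsion ((3 : ℕ) : ℤ) ≃+ (Fin 2 → ZMod 3), ∀ (σ : Field.absoluteGaloisGroup K) (P : (E.baseChange K).geomTorsion ((3 : ℕ) : ℤ)), e (σ • P) = ((ρ σ : GL (Fin 2) (ZMod 3)) : Matrix (Fin 2) (Fin 2) (ZMod 3)) *ᵥ (e P)) ∧ ((∀ σ : Field.absoluteGaloisGroup K, (ρ σ : GL (Fin 2) (ZMod 3)) ∈ Subgroup.closure ({(⟨!![1, 0; 0, 2], !![1, 0; 0, 2], by decide, by decide⟩ : GL (Fin 2) (ZMod 3)), (⟨!![0, 1; 1, 0], !![0, 1; 1, 0], by decide, by decide⟩ : GL (Fin 2) (ZMod 3))} : Set (GL (Fin 2) (ZMod 3)))))) →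
          (∃ ρ : Literature.NumberTheory.GaloisRepresentations.FramedGaloisRep K (ZMod 5) 2, (∃ e : (E.baseChange K).geomTorsion ((5 : ℕ) : ℤ) ≃+ (Fin 2 → ZMod 5), ∀ (σ : Field.absoluteGaloisGroup K) (P : (E.baseChange K).geomTorsion ((5 : ℕ) : ℤ)), e (σ • P) = ((ρ σ : GL (Fin 2) (ZMod 5)) : Matrix (Fin 2) (Fin 2) (ZMod 5)) *ᵥ (e P)) ∧ ((∀ σ : Field.absoluteGaloisGroup K, (ρ σ : GL (Fin 2) (ZMod 5)) ∈ Subgroup.closure ({(⟨!![3, 1; 3, 3], !![3, 4; 2, 3], by decide, by decide⟩ : GL (Fin 2) (ZMod 5)), (⟨!![1, 0; 0, 4], !![1, 0; 0, 4], by decide, by decide⟩ : GL (Fin 2) (ZMod 5))} : Set (GL (Fin 2) (ZMod 5)))))) →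
          ∀ r : K, r ^ 2 = 5 →
            (E.baseChange K).c₄ = 0 ∨
            (E.baseChange K).c₄ ^ 3 = 8000 * (E.baseChange K).Δ ∨
            ∃ u t w : K, u ≠ 0 ∧
              (E.baseChange K).c₄ ^ 3 * u ^ 3 = 27 * (u + 1) ^ 3 * (u - 3) ^ 3 * (E.baseChange K).Δ ∧
              t ^ 2 + t - 1 ≠ 0 ∧
              (E.baseChange K).c₄ ^ 3 * (t ^ 2 + t - 1) ^ 5 =
                125 * (t + 1) * (2 * t + 1) ^ 3 * (2 * t ^ 2 - 3 * t + 3) ^ 3 * (E.baseChange K).Δ ∧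
              (5 + 2 * r) * w ^ 2 = 8 * t ^ 2 - 12 * t + 7)
    (hDat' : ∀ (K : Type) [Field K] [NumberField K], NumberField.IsTotallyReal K → Module.finrank ℚ K = 4 →
        ∀ r : K, r ^ 2 = 5 →
          ∀ t n v w : K,
            n ^ 3 = t ^ 3 + 2 * t ^ 2 - 1 →
            v ^ 2 = (5 * (2 * t + 1) * (2 * t ^ 2 - 3 * t + 3) * n) ^ 2
                + 12 * (5 * (2 * t + 1) * (2 * t ^ 2 - 3 * t + 3) * n) * (t ^ 2 + t - 1) ^ 2
                + 144 * (t ^ 2 + t - 1) ^ 4 →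
            (5 + 2 * r) * w ^ 2 = 8 * t ^ 2 - 12 * t + 7 →
            v ≠ 0 → w ≠ 0 →
            (∃ a b : ℚ, t = (a : K) + (b : K) * r) ∧ (∃ a b : ℚ, n = (a : K) + (b : K) * r)) :
    CertS3H12 :=
  certS3H12_of_modelIdentification_of_caseTwoEmpty hNF fun K _ _ hK hd r hr t n v w hn hv hW => by
    haveI : IsTotallyReal K := hK
    exact caseTwo_of_smooth hr hn hv hW (hDat' K hK hd r hr t n v w hn hv hW)

end Summit.Langlands.Langlands.Theorems.SqrtFiveQuarticCovers

end
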